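import Mathlib
import HarnessLib
import HarnessLib.Audit
import Summits.KontsevichZagierPeriods.Statement
import Literature.NumberTheory.Transcendental.KZRelationsLE
import HarnessLib.Audit.Status.Attr

/-!
Route: DimensionBudget

DORMANT since 2026-08-23T18:04:15Z (reconciler: no traction for 6.1 d (last activity statement-closed at 2026-08-17T13:55:45Z); parked, not closed — `ledger route dormant route-KontsevichZagierPeriods-DimensionBudget --off` to reactivat) — unstaffed, not closed; items shared with open routes are served there. `ledger route dormant <id> --off` reactivates.

# Route DimensionBudget — KZ Conjecture 1 with a dimension budget — truncated calculi K_≤d, 'Stokes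
costs one dimension', and the budgeted Baker sector

It suffices to show the BUDGETED form of Conjecture 1: every two equal-valued integral
representations of KZ's literal shape are
connected by moves of the H21 calculus taken among representations of ambient dimension ≤ d for some
d (relations_≤d := the subgroup
generated by the move instances supported on representations of dimension ≤ d; by exhaustion
relations = ⨆_d relations_≤d this is
equivalent to the summit). The route realises idea card proof-complexity-of-the-calculus: it makes
"how many variables does a
rules-proof need" (KZ 2001 §1.2 Problem 2 'ink'; Ayoub 2015 Rem. 1.2/1.5 'plus de n+1 variables') a
theorem-bearing invariant of the
fixed calculus, and files the first three budget theorems: a LOWER bound (dimension 1 is not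
conservative: Cauchy/Stokes for a
holomorphic form along a non-real algebraic loop costs exactly one extra dimension), an UPPER bound
(the rational = Baker sector of
dimension ≤ 1 closes inside dimension ≤ 1), and the corrected d(1)-conjecture (one extra dimension
always suffices in dimension 1).
Lean: `∀ ⦃n m : ℕ⦄ (r : Literature.NumberTheory.Transcendental.KZ.IntegralRep n) (r' :
Literature.NumberTheory.Transcendental.KZ.IntegralRep m), r.IsRational → r'.IsRational → r.value =
r'.value → ∃ d : ℕ, Literature.NumberTheory.Transcendental.KZ.of r -
Literature.NumberTheory.Transcendental.KZ.of r' ∈ AddSubgroup.closure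
((Literature.NumberTheory.Transcendental.KZ.domainAddRel ∪
Literature.NumberTheory.Transcendental.KZ.integrandAddRel ∪
Literature.NumberTheory.Transcendental.KZ.changeOfVariablesRel ∪
Literature.NumberTheory.Transcendental.KZ.newtonLeibnizRel) ∩ (AddSubgroup.closure {x :
Literature.NumberTheory.Transcendental.KZ.FormalRep | ∃ (k : ℕ) (s :
Literature.NumberTheory.Transcendental.KZ.IntegralRep k), k ≤ d ∧ x =
Literature.NumberTheory.Transcendental.KZ.of s} : Set
Literature.NumberTheory.Transcendental.KZ.FormalRep))`

## Assembly
Two layers by dimension, glued by pure logic (support BudgetGlue : BakerSectorDimOne →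
OneExtraDimension → BudgetThesis,
proved in the planner's Sketch.lean as a calibration): for a KZ-rational equal-valued pair either
max n m ≤ 1, and crux
BakerSectorDimOne connects it inside relations_≤1 (d := 1), or max n m ≥ 2, and the open core
OneExtraDimension connects it
inside relations_≤(max n m + 1); hence BudgetThesis, and relations_≤d ≤ relations
(AddSubgroup.closure_mono of
inter_subset_left) gives `KZ.Equivalent r r'`, i.e. the summit (deciding theorem `closes (h :
BudgetThesis)`, unchanged).
Honesty clause: OneExtraDimension alone is already at least summit strength (padding r ↦ r × (0,1)
is one Newton–Leibniz
move, so it decides every pair with d ≤ 3); the route's unconditional content is the dimension-1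
layer (cruxes 2–4: the
budget function at layer 1 is D(1) = 2 exactly, = 1 on the Baker sector) and the calibrations; the
open core is filed to
make the target's dependency explicit and to give the budget FUNCTION a refutable form ('+1'), not
for staffing.

Rationale: WHY THIS LINE. The calculus of `Literature.NumberTheory.Transcendental.KZCalculus` is filtered by
ambient dimension: relations_≤d ⊆ relations_≤d+1, and
the truncated quotients K_≤d = FormalRep_≤d ⁄ relations_≤d are NOT stabilised by extra variables, so
— exactly as for polytopes under
isometries only (Dehn) — additive invariants can exist on K_≤d although none is known on the full
quotient (Neg 0313 found none);
each such invariant separating a KZ-equivalent pair is a theorem "this identity needs dimension >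
d", the rigorous form of Ayoub2015
Rem. 1.2/1.5 and of KontsevichZagier2001 Problem 2. New engine (beyond the card): in dimension 1 the
move relations are generated by
subdivision, semialgebraic SUBSTITUTION and ALGEBRAIC exactness, so the class of the algebraic
1-form f dt in the de Rham cohomology of
the function field modulo substitutions is an invariant; logarithms and REAL elliptic arcs die under
the duplication substitutions
x ↦ x², x ↦ x(2P) (so Baker's sector and torsion/isogeny/CM identities such as B(1/6,1/2) =
√3·B(1/3,1/2), realised by the real
3-isogeny of y² = x³+1 to its −3-twist, stay inside dimension 1), whereas the primitive along a
NON-real loop (real part of an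
elliptic logarithm) has no functional equation realisable by substitutions of the real parameter —
functional transcendence
(Ax1971 proved in tree as `Literature.NumberTheory.Transcendental.ax_schanuel_holds`; elliptic:
Ax1972, BrownawellKubota1977,
Kirby2009; value-level relatives: Bertrand2009, BakkerTsimerman2025) is imported as a
PROOF-COMPLEXITY lower-bound tool. Upper
bounds import transcendence (Baker1975 Thm 2.1 = `baker_holds`) and the generator theorem
HuberWustholz2022 Thm 13.3 ((A)
bilinearity, (B) functoriality of pairs of curves, (C) boundary); (A),(B) are dimension-1 moves
(integrand additivity; chain rule),
(C) is Green's theorem = two Newton–Leibniz moves in dimension 2. Prior routes: LowDimension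
(blocked) proves d ≤ 1 completeness with
intermediates of ANY dimension; Neg hunts an invariant of the FULL quotient; this line sits strictly
between them and its negative
theorems are compatible with the summit.
Sibling route UnfoldedStokes (opened today, card unfolding-abelian-integrals-riemann-bilinear)
supplies the matching UPPER-bound
mechanism — Stokes for f·η with f an abelian integral is a chain of moves in ONE more variable (f
carried as ∫₀¹Ω(p,u)du); crux 2 here
is the LOWER bound that an extra variable cannot be dispensed with already for Cauchy-type
identities of 1-dimensional reps, and
crux 4 says one extra variable is also enough throughout dimension 1.

RANKED CRUXES. #0 BudgetThesis (target) — Conjecture 1 with an explicit (per-pair) dimension budget: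
equal-valued rational representations r, r' are connected inside relations_≤d for some d. Equivalent
to the summit via Exhaustion; the route's content is WHICH d (and which chain length) per sector.
(why it might fail: Equivalent to the summit (support Exhaustion + Assembly); false iff Conjecture 1
fails for the H21 calculus (route Neg's bet).) [KontsevichZagier2001, Ayoub2015]
#2 DimOneNotConservative (crux) — Dimension 1 is NOT conservative: there are representations r, r'
of dimensions ≤ 1 that are KZ-equivalent (through higher dimensions) but not connected by moves
among representations of dimension ≤ 1. Proposed witness: r = ∫_ℝ Re(x'(t)/y(t)) dt for a
ℚ-semialgebraic parametrisation t ↦ (x(t),y(t)) of a small non-real loop on y² = x³ − x (lift of |x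
− 2| = 1/2), r' = the empty 0-dimensional rep; value 0 = Re∮ dx/y (Cauchy); KZ-equivalent through
dimension 2 by Green (two Newton–Leibniz moves with the ALGEBRAIC primitives P, Q of the pulled-back
closed form, one swap change of variables); the lower bound is an additive invariant on FormalRep
killing the move instances supported in dimension ≤ 1 (candidate: class of the algebraic 1-form in
H¹_dR of the function field, modulo substitutions) shown non-zero on r by elliptic Ax–Schanuel-type
functional transcendence. [UPDATE 2026-08-16: that PROPOSED witness is dead — its integrand is odd
under t ↦ −t, so the pair closes inside dimension 1 in three moves (refuter evidence
evidence_3749_symmetry.md); the ∃-item stands; next candidates are non-real loops with no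
conjugation/translation symmetry (genus 2, cf. stmt-6260; Fermat degree 9).] Its negation is the
card's d(1)=1 conjecture in conservativity form; settling it either way is the most informative
event of the route. [difficulty: XL] (why it might fail: Coinvariants may vanish: integrand
additivity lets a chain borrow auxiliary curves, and telescoping F∘Ψ−F over substitutions might kill
the loop class (logs and REAL elliptic arcs already die under duplication x↦x(2P)); then dimension 1
is conservative and the item is false.) [Ayoub2015, Ax1971, Ax1972, BrownawellKubota1977, Kirby2009,
HuberWustholz2022, BakkerTsimerman2025]
#3 BakerSectorDimOne (crux) — The rational (= Baker) sector of dimension ≤ 1 closes INSIDE dimension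
≤ 1: two representations of KZ's literal shape of dimensions ≤ 1 with equal values are connected by
moves among representations of dimension ≤ 1. Budgeted refinement of LowDimension's crux
stmt-KontsevichZagierPeriods-0405 (same normal form: cell decomposition of the domain, partial
fractions by integrand additivity, affine/Möbius/power-map changes of variables, Newton–Leibniz 1→0
with rational/algebraic primitives, Baker — PROVED in tree as
Literature.NumberTheory.Transcendental.baker_holds — to reduce ℚ̄-relations among 1, log α_j, arg
w_k to multiplicative ℤ-relations, realised by domain additivity + x ↦ αx, x ↦ x^N, Möbius
doubling); the new content is that no step leaves dimension ≤ 1 (no product representation, no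
Fubini). [difficulty: L] (why it might fail: LowDimension 0405 (unbudgeted) is itself unproved; the
budget could break at arctan/torsion bookkeeping (Möbius doubling wraps through ∞) or if a
normal-form step silently needs a product rep — cf. Ayoub2015 Rem 1.5: a one-variable substitution
costs two variables in his calculus.) [Baker1975, BakerWustholz2007, Waldschmidt2000,
KontsevichZagier2001, Ayoub2015, HuberWustholz2022]
#4 DimOneWithinTwo (crux) — One extra dimension suffices in dimension 1 (the corrected
d(1)-conjecture, d(1) = 2): whenever two representations of dimensions ≤ 1 (semialgebraic
integrands: all 1-periods of curve type, real parts) are KZ-equivalent, they are connected by moves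
among representations of dimension ≤ 2. Expected proof: soundness (relations_le_ker_eval_holds)
gives equal values; HuberWustholz2022 Thm 13.3(2) (all ℚ̄-linear relations among curve-type periods
come from bilinearity and functoriality of pairs (C,D) of smooth affine curves, plus boundary maps)
supplies generators; realisation: (A) = integrand/domain additivity (dim 1), (B) = chain rule along
semialgebraic paths (dim 1, literally EqOn of integrands), homology/boundary relations (C) = Green
on semialgebraic 2-chains in C(ℂ) ⊂ ℝ⁴ pulled back to parameter squares (dim 2). [difficulty: XL]
(why it might fail: Needs Huber–Wüstholz Thm 13.3 (not in tree) to turn equal values into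
generators; functoriality through NON-real paths may need homotopies whose Stokes realisation nests
(d = 3), and every intermediate curve-type period must be the real part of an absolutely convergent
rep.) [HuberWustholz2022, HuberMullerStachPeriods2017, KontsevichZagier2001, Ayoub2015]
#9 Exhaustion (support) — The dimension filtration exhausts the relations: relations = ⨆_d
relations_≤d (every move instance is supported in the dimension of its representations; conversely
relations_≤d ≤ relations by closure_mono). With BudgetThesis this shows the target is an honest
reformulation of the summit. Provable now (AddSubgroup.closure_le / mem_iSup_of_directed).
[difficulty: provable-now] [KontsevichZagier2001]
#9 BaselWithinTwo (support) — Calibration of the budget at d = 2: Euler's ζ(2) = π²/6, as the pair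
(∫∫_(0,1)² dxdy/(1−xy), ∫∫_(0,1)² (8/3)dxdy/((1+x²)(1+y²))), closes INSIDE dimension 2 in about ten
moves: integrand additivity 1/(1−xy) = 1/(1−x²y²) + xy/(1−x²y²); change of variables (x²,y²) turns
the odd part into a quarter of the whole; the scaling endomorphism of FormalRep (integrands × λ, λ
real algebraic) preserves relations_≤d, giving ζ-rep ≡ (4/3)·S; the ALGEBRAIC Calabi map Φ(s,t) =
(s/√(1−t²), t/√(1−s²)) from the quarter disc onto (0,1)² (Beukers–Calabi–Kolk) pulls dxdy/(1−x²y²)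
back to ds dt/(√(1−s²)√(1−t²)); the involution (s,t) ↦ (√(1−s²),√(1−t²)) swaps quarter disc and its
complement in the square preserving that integrand, so quarter disc = half the square (domain
additivity); finally the product change of variables (s,t) = (2x/(1+x²), 2y/(1+y²)) maps (2/3)ds
dt/(√(1−s²)√(1−t²)) on (0,1)² to (8/3)dxdy/((1+x²)(1+y²)). No third variable: evidence that
Fubini-type product identities do not force d = 3. [difficulty: L] [BeukersCalabiKolk1993,
KontsevichZagier2001]
#9 LogSectorTwoMoves (crux since the AUTO-CRUX pass of 2026-08-16 — conjecture-grade wording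
'conjecturally O_δ(log log H)'; the typed statement has a complete paper proof, refuter
route-review) — Effective KZ in the logarithmic sector is TWO moves: if ∫_a^b c dx/x = ∫_a'^b' c'
dx/x (rational data, c ≠ 0) then with α = b/a, β = b'/a', α^P = β^Q (P, Q ≥ 1 from c/c' = P/Q) and δ
= α^(1/Q) = β^(1/P) (real algebraic), the power maps y ↦ a·y^Q and y ↦ a'·y^P send the single rep
∫_1^δ (cQ) dy/y (cQ = c'P) onto r and r' — two change-of-variables instances, both supported in
dimension 1, independent of all heights. Shows that proof LENGTH in the Baker sector is governed by
power maps (the card's (E) is O_δ(1) in the pure-log sector; conjecturally O_δ(log log H) in general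
because e-fold angle multiplication needs Möbius doubling). [difficulty: M] [KontsevichZagier2001,
Baker1975]
#9 OneExtraDimension (support; OPEN CORE, filed 2026-08-16 on the operator's route-choice hold
'target-unreachable') — layers of dimension ≥ 2: two representations of KZ's literal shape with max
n m ≥ 2 and equal values satisfy KZ.EquivalentLE (max n m + 1) r r' — one passes from r to r' among
representations of dimension ≤ max n m + 1 ('Stokes costs exactly one dimension' made global: D(N) ≤
N + 1 for N ≥ 2). At least summit strength (padding r ↦ r × (0,1) is one Newton–Leibniz move, so it
decides every pair, with d ≤ 3 on layer ≤ 1) and SHARPER than the summit, hence separately refutable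
by a '+2 is needed' theorem; not for staffing. Calibrations, all consistent with +1: Basel inside 2
= max + 0 (BaselWithinTwo); Hoffman's relation of weight w among w-dimensional cubical
representations inside w + 1 (Theorems/FurushoPentagonHoffmanRelationInKZ: the peak representation
adds the single variable λ, and its Disproof shows Newton–Leibniz is necessary at s = (3), so +1 is
attained); Stokes for f·η with f an abelian integral in ONE more variable (UnfoldedStokes); KZ's π
(disc ↔ ∫dx/(1+x²)) inside 2. (why it might fail: false as soon as one identity of n-dimensional
periods is forced only through dimension ≥ n + 2 — nested boundary maps, regularised double shuffle,
cycles on higher products; Ayoub2015 Rem. 1.2 expects 'plus de n + 1 variables' for the cube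
calculus, where a one-variable substitution already costs two variables, Rem. 1.5 = Fresan2024 Rem.
3.7 — in KZ's calculus substitution is rule 2) and costs nothing, which is the bet.) [difficulty:
open-problem] [KontsevichZagier2001, Ayoub2015, Fresan2024, HuberMullerStachPeriods2017, Wan2011]
#9 BudgetGlue (support; glue, provable now — planner's Sketch.lean `budgetGlue_holds`, lean check rc
0) — BakerSectorDimOne → OneExtraDimension → BudgetThesis by a case split on max n m: d := 1 from
BakerSectorDimOne if max n m ≤ 1, else d := max n m + 1 from OneExtraDimension (KZ.EquivalentLE /
KZ.relationsLE unfold to the inlined truncation by rfl). Makes the target the conclusion of the two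
layers; cruxes 2 and 4 measure the budget function at layer 1 (D(1) = 2 exactly) and stay outside
the glue by design. [difficulty: provable-now] [KontsevichZagier2001]

TWO-LAYER PLAN. FILED 2026-08-16 (route-choice (a)): BudgetThesis ⇐ BakerSectorDimOne →
OneExtraDimension → BudgetThesis (glue BudgetGlue, provable now); OneExtraDimension has no foreseen
split (summit strength) — if it is ever attacked, by layer, the d = 2 rational sector first
(Legendre 0280, triplication 0312, products of two 1-periods: is D(2) = 2?). Foreseen glued splits
(nothing else filed now): BakerSectorDimOne ⇐ NormalFormDimOne (every rational rep of dim ≤ 1 is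
≡_≤1 to a
ℤ-combination of standard reps ∫_1^α A/x, ∫_s^t B/(1+u²), constants) → RealiseDimOne (every
multiplicative ℤ-relation among the
α's and unit-circle w's is realised inside relations_≤1) → BakerSectorDimOne (glue = coefficient
matching by baker_holds).
DimOneNotConservative ⇐ CauchyLoopWithinTwo (the explicit loop rep is ≡ 0 through dimension 2;
support) → InvariantLEOne (an
additive ι : FormalRep →+ A vanishing on the move instances supported in dimension ≤ 1 with ι(loop
rep) ≠ 0) → DimOneNotConservative
(glue = AddSubgroup.closure_le, the budgeted form of Neg 0313). DimOneWithinTwo ⇐ (HuberWustholz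
curve-type fact, when it lands as a
Literature def) → RealiseGeneratorsABC → DimOneWithinTwo.

KILL CRITERIA. Refutation of BakerSectorDimOne by a pair that IS KZ-equivalent but needs dimension 2
→ restate as 'within 2' and record the
witness as the first lower-bound theorem (the line survives, the sector claim dies); by a pair that
is not KZ-equivalent at all →
that refutes the summit (hand to Neg/operator). Proof of the negation of DimOneNotConservative
(dimension 1 conservative) together
with BakerSectorDimOne → the card's d(1)=1 holds: close the route as delivered/superseded by a d = 2
layer route. Refutation of
DimOneWithinTwo (a curve-type identity needing d ≥ 3) → pivot: the budget FUNCTION d ↦ D(d) becomes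
the object (restate with 3).
Refutation of OneExtraDimension by an identity of n-dimensional rational representations that
provably needs a representation of dimension n + 2 (a truncated invariant ι_(n+1) separating a
KZ-equivalent pair) → the first lower bound of its kind and NOT a defeat of the line: restate the
open core with the witnessed budget (or in bare ∃-budget form, the summit remainder) within the
grace window; by a pair that is not KZ-equivalent at all → summit refuted (Neg/operator). BudgetGlue
cannot be refuted (proved in Sketch.lean). Refutation of BudgetThesis = refutation of the summit
(route Neg).

NOT DECOMPOSED YET. The d = 2 layer (is Legendre's relation Grothendieck 0280, the triplication pair
Neg 0312, the stuffle ζ(4)=4ζ(3,1) Grothendieck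
0275 inside relations_≤2, ≤3, ≤4?) — wait for BaselWithinTwo and crux 2; the general effective
statement (E) of the card (chain
length ≤ C(δ)(log H + 2)^k for rational reps of degree ≤ δ, height ≤ H on a rational interval, via
Loxton–van der Poorten/Masser
bounds on multiplicative relations; conjecturally C(δ)(1 + log log H)) — filed only in its
height-free log-sector form; the explicit
Cauchy-loop calibration rep (nested real radicals) — left to the prover of crux 2, who may choose
the curve and loop; uniform budget functions D(N) beyond the '+1' form now filed for layers ≥ 2
(OneExtraDimension) — in particular whether D(2) = 2 on the rational layer-2 sector (Basel: yes for
ζ(2) = π²/6) and the padding/depadding bookkeeping 'layer ≤ 1 inside 3 ⇒ inside 2'; truncated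
invariants ι_2 (Dehn-type) for d = 2.

CHEAPEST FALSIFIER. (i) [RUN by a refuter 2026-08-15, evidence_3749_symmetry.md: the PROPOSED
witness of crux 2 is dead — Re(x′/y) over the lift of |x − 2| = 1/2 on y² = x³ − x is odd under t ↦
−t and closes inside dimension 1 in three moves (1a, rule 2, 1b); the ∃-item survives.] Exhibit a
dimension-≤1 chain for Re∮ dx/y over a non-real algebraic loop WITHOUT conjugation/translation
symmetry (genus 2, cf. stmt-6260; Fermat degree 9) — that would kill the next witness, not yet the
item; on paper none exists: Newton–Leibniz needs the real part of an elliptic logarithm along the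
loop to be
semialgebraic (excluded by Ax–Schanuel-type transcendence unless the loop has a
conjugation/translation symmetry), and substitutions
of the real parameter cannot realise [2]; (ii) checked on paper that the obvious 'CM needs d = 2'
candidates are FALSE alarms:
∫_0^∞dx/√(1+x³) = 2∫_-1^0 dx/√(1+x³) is torsion via the real duplication map, B(1/6,1/2) =
√3·B(1/3,1/2) is the real 3-isogeny
y²=x³+1 → y²=x³−27; (iii) for crux 3: any equal-valued pair of rational 1-dim reps whose only chain
uses a product rep — none found
(partial fractions, power maps and Möbius doubling stay in dimension 1); (iv) numerics: both Basel
reps = 1.6449340668; (v) for OneExtraDimension: read off the dimensions of the chains already in the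
tree — Hoffman weight w inside w + 1 ✓, unfolded Stokes + 1 ✓, Basel + 0 ✓, π inside 2 ✓; the first
identity whose only known chain needs + 2 is the falsifier candidate (none known; watch ζ(4) =
4ζ(3,1), Grothendieck 0275, and the regularised double-shuffle sector of FurushoPentagon).

NUMBERS. ζ(2) = π²/6 = (8/3)(π/4)² = 1.6449340668…; B(1/3,1/6) = 8.4131 = 2·B(1/3,1/2) (torsion, dim
1); B(1/6,1/2) = 7.2858 = √3·B(1/3,1/2)
(3-isogeny, dim 1); KZ §1.1: π = ∬_(x²+y²≤1) = 2∫√(1−x²) = ∫dx/(1+x²) needs d = 2 only for the first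
rep (Wan2011: deg π = 2 at the
VALUE level; no period of degree ≥ 3 is known — Wan's Problem 1); log sector: chain length 2 for
every identity, any height.

DEFINITION REQUESTS. KZ.formalRepLE d / KZ.relationsLE d / KZ.EquivalentLE d r r' / KZ.ChainLE d ℓ
have LANDED (Literature/NumberTheory/Transcendental/KZRelationsLE.lean, 2026-08-15: relationsLE_def
rfl, ChainLE, scale_mem_relationsLE, relations_eq_iSup_relationsLE = support Exhaustion); since rev
2 the route imports that file, the new items are stated over KZ.EquivalentLE, and the original
signatures keep the rfl-equal inlined form (migration is a no-op restate, left to tenure). Cite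
facts wanted: Ax–Schanuel for semiabelian varieties / Weierstrass ℘ (Ax1972 Thm 1;
BrownawellKubota1977;
Kirby2009 Thm 1.x) as a named fact next to ax_schanuel; Huber–Wüstholz Thm 13.3(2) in curve-type
form (already wanted by LowDimension
items 0117/0510 — not re-filed).

Novelty: Searches (2026-08-15): lit search --hybrid ×3 ('Kontsevich-Zagier period conjecture number of
variables needed change of variables
Stokes bounded dimension' → HW2022 pp 10-11,121; 'functional transcendence of periods geometric
Andre Grothendieck' → Pila2022 pp
94-95, ch. 17; Baker/BW books), lit vsearch ×1 (one-dimensional reps transformed without a second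
variable → 0 relevant), lit galaxy
search --star all ×3 ('Kontsevich-Zagier conjecture' 0; 'conjecture of Kontsevich and Zagier' 2:
LNCS computability volume,
arXiv:1506.00318 Zhou interaction entropies; 'Kontsevich–Zagier' 3 books: MurtyRath, LNM 2313,
Pila2022), lit frontier
KontsevichZagierPeriods --since 2020 (30 rows: GPC for Kummer surfaces arXiv:2303.05030, MZV/odd
zeta items — none on rules-proof
resources), zbMATH (BakkerTsimerman2025 = arXiv:2208.05182), plus the card audit's reads (Wan2011 =
arXiv:1102.2273 pp 3,5-6; Ayoub2015
Rem 1.2/1.5; Fresan2024 Rem 3.7; LairezSertoz doi:10.2140/ant.2023.17.1753). Plain FTS `lit search`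
was down (connection reset) during
the session; OpenAlex/S2/arXiv rate-limited.
Nearest prior art found: Wan2011 (degree of a PERIOD = least dimension of a volume representation;
value-level filtration that K_≤d
refines; 'no period of degree ≥ 3 known'); Ayoub2015 Rem 1.2/1.5 + Fresan2024 Rem 3.6/3.7 (heuristic
'plus de n+1 variables'; 1-variable
substitution = Stokes elements in 2 variables in the cube calculus); HuberWustholz2022 Thm 13.3
(generators of all linear relations of
1-periods); f  [refs: 10.2140/ant.2023.17.1753, 1506.00318, 2303.05030, 2208.05182, 1102.2273, doi:10.2140/ant.2023.17.1753, Pila2022, BakkerTsimerman2025, Wan2011, Ayoub2015, Fresan2024, HuberWustholz2022, Bertrand2009, BeukersCalabiKolk1993]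

Barriers (technique_class: resource-truncated calculus, functional-transcendence): - technique_class: resource-truncated calculus, functional-transcendence
- Literature.Barriers.KontsevichZagierPeriods.noSemialgebraicPrimitive_inv_sub_two: engaged as a
RESOURCE, not evaded: the barrier (no semialgebraic primitive of 1/(t−2); 'fixing the number of
variables has little chance') kills fixed-variable COMPLETENESS proofs; this line fixes d only to
prove INcompleteness of K_≤1 (crux 2 turns Ayoub's heuristic into a theorem with an elliptic instead
of a logarithmic primitive — the logarithmic example is NOT a lower-bound witness since
∫_0^1dt/(2−t)=∫_1^2dt/t is one substitution, exactly the barrier's scope caveat) and claims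
completeness inside d ≤ 1 only for the rational sector, where every primitive used is
rational/algebraic (Newton–Leibniz 1→0 for polynomial and (x−ρ)^-k parts) and logs are never
integrated out but matched by substitutions.
- Literature.Barriers.KontsevichZagierPeriods.kzConjecture_implies_oddZetaAlgIndep: strength barrier
for POSITIVE routes to the full summit; untouched — the target is summit-equivalent and inherits it,
but the staffed cruxes are sector statements (dimension ≤ 1, Baker/Huber–Wüstholz regimes where
transcendence input exists) and a negative-compatible lower bound; the bet is that budget theorems
are provable exactly where GPC-type input is already a theorem.
- Literature.Barriers.KontsevichZagierPeriods.kzConjecture_implies_twoPiI_log_algIndep: same status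
(strength barrier; the dimension-1 sector only meets ℚ̄-LINEAR relatio

History (route lifecycle, newest last):
- 2026-08-16T02:17:47Z · AUTO-CRUX: 2 conjecture-grade item(s) promoted to crux (BudgetThesis, LogSectorTwoMoves) — refuter vetting / tiering apply (operator:999:1362873)
- 2026-08-16T04:08:11Z · AUTO-CRUX (backfill): BudgetThesis — hypotheses of the deciding theorem that nothing in the route derives are cruxes (operator:999:1085951)
- 2026-08-23T18:04:15Z · DORMANT — reconciler: no traction for 6.1 d (last activity statement-closed at 2026-08-17T13:55:45Z); parked, not closed — `ledger route dormant route-KontsevichZagierPer (operator:999:2157753)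

sub-problem: KontsevichZagierPeriods · status: dormant · opened planner-plancard-KontsevichZagierPeriods-Kont-23e314af-0 2026-08-15T11:23:48Z · rev 3 · ledger route-KontsevichZagierPeriods-DimensionBudget
GENERATED by the gate from the ledger (D-0016/17). Provers cite these decls: `theorem foo : Summit.KontsevichZagierPeriods.KontsevichZagierPeriods.Theses.DimensionBudget.<Decl> := …` in Summits/KontsevichZagierPeriods/KontsevichZagierPeriods/Theorems/<Name>.lean.
-/

namespace Summit.KontsevichZagierPeriods.KontsevichZagierPeriods.Theses.DimensionBudget

open scoped BigOperators Topology Manifold Classical MeasureTheory ProbabilityTheory Matrix InnerProductSpace ComplexConjugate ContinuousMap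
open Filter Set Function TopologicalSpace MeasureTheory

attribute [summit_statement] _root_.KontsevichZagierPeriods

open Literature Periods

/-- item stmt-KontsevichZagierPeriods-3748 · crux (kind.auto-crux: conjecture-grade) · rank 0 · open · by planner
why it might fail: Equivalent to the summit (support Exhaustion + Assembly); false iff Conjecture 1 fails for the H21 calculus (route Neg's bet).
sources: KontsevichZagier2001, Ayoub2015
[target] Conjecture 1 with an explicit (per-pair) dimension budget: equal-valued rational
representations r, r' are connected inside relations_≤d for some d. Equivalent to the summit via
Exhaustion; the route's content is WHICH d (and which chain length) per sector. -/
@[route_item "route-KontsevichZagierPeriods-DimensionBudget", crux]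
def BudgetThesis : Prop :=
  ∀ ⦃n m : ℕ⦄ (r : Literature.NumberTheory.Transcendental.KZ.IntegralRep n) (r' : Literature.NumberTheory.Transcendental.KZ.IntegralRep m), r.IsRational → r'.IsRational → r.value = r'.value → ∃ d : ℕ, Literature.NumberTheory.Transcendental.KZ.of r - Literature.NumberTheory.Transcendental.KZ.of r' ∈ AddSubgroup.closure ((Literature.NumberTheory.Transcendental.KZ.domainAddRel ∪ Literature.NumberTheory.Transcendental.KZ.integrandAddRel ∪ Literature.NumberTheory.Transcendental.KZ.changeOfVariablesRel ∪ Literature.NumberTheory.Transcendental.KZ.newtonLeibnizRel) ∩ (AddSubgroup.closure {x : Literature.NumberTheory.Transcendental.KZ.FormalRep | ∃ (k : ℕ) (s : Literature.NumberTheory.Transcendental.KZ.IntegralRep k), k ≤ d ∧ x = Literature.NumberTheory.Transcendental.KZ.of s} : Set Literature.NumberTheory.Transcendental.KZ.FormalRep))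

/-- item stmt-KontsevichZagierPeriods-3749 · crux · rank 2 · open · by planner
why it might fail: Coinvariants may vanish: integrand additivity lets a chain borrow auxiliary curves, and telescoping F∘Ψ−F over substitutions might kill the loop class (logs and REAL elliptic arcs already die under duplication x↦x(2P)); then dimension 1 is conservative and the item is false.
sources: Ayoub2015, Ax1971, Ax1972, BrownawellKubota1977, Kirby2009, HuberWustholz2022
[crux] Dimension 1 is NOT conservative: there are representations r, r' of dimensions ≤ 1 that are
KZ-equivalent (through higher dimensions) but not connected by moves among representations of
dimension ≤ 1. Proposed witness: r = ∫_ℝ Re(x'(t)/y(t)) dt for a ℚ-semialgebraic parametrisation t ↦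
(x(t),y(t)) of a small non-real loop on y² = x³ − x (lift of |x − 2| = 1/2), r' = the empty
0-dimensional rep; value 0 = Re∮ dx/y (Cauchy); KZ-equivalent through dimension 2 by Green (two
Newton–Leibniz moves with the ALGEBRAIC primitives P, Q of the pulled-back closed form, one swap
change of variables); the lower bound is an additive invariant on FormalRep killing the move
instances supported in dimension ≤ 1 (candidate: class of the algebraic 1-form in H¹_dR of the
function field, modulo substitutions) shown non-zero on r by elliptic Ax–Schanuel-type functional
transcendence. Its negation is the card's d(1)=1 conjecture in conservativity form; settling it
either way is the most informative event of the route. [difficulty: XL] -/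
@[route_item "route-KontsevichZagierPeriods-DimensionBudget"]
def DimOneNotConservative : Prop :=
  ∃ (n m : ℕ) (r : Literature.NumberTheory.Transcendental.KZ.IntegralRep n) (r' : Literature.NumberTheory.Transcendental.KZ.IntegralRep m), n ≤ 1 ∧ m ≤ 1 ∧ Literature.NumberTheory.Transcendental.KZ.Equivalent r r' ∧ Literature.NumberTheory.Transcendental.KZ.of r - Literature.NumberTheory.Transcendental.KZ.of r' ∉ AddSubgroup.closure ((Literature.NumberTheory.Transcendental.KZ.domainAddRel ∪ Literature.NumberTheory.Transcendental.KZ.integrandAddRel ∪ Literature.NumberTheory.Transcendental.KZ.changeOfVariablesRel ∪ Literature.NumberTheory.Transcendental.KZ.newtonLeibnizRel) ∩ (AddSubgroup.closure {x : Literature.NumberTheory.Transcendental.KZ.FormalRep | ∃ (k : ℕ) (s : Literature.NumberTheory.Transcendental.KZ.IntegralRep k), k ≤ 1 ∧ x = Literature.NumberTheory.Transcendental.KZ.of s} : Set Literature.NumberTheory.Transcendental.KZ.FormalRep))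

/-- item stmt-KontsevichZagierPeriods-3750 · crux · rank 3 · closed · proved by Summit.KontsevichZagierPeriods.DimensionBudget.BakerSectorDimOne.bakerSectorDimOne_proof @ d4c1e3c7bbf7 (prover) · by planner
why it might fail: LowDimension 0405 (unbudgeted) is itself unproved; the budget could break at arctan/torsion bookkeeping (Möbius doubling wraps through ∞) or if a normal-form step silently needs a product rep — cf. Ayoub2015 Rem 1.5: a one-variable substitution costs two variables in his calculus.
sources: Baker1975, BakerWustholz2007, Waldschmidt2000, KontsevichZagier2001, Ayoub2015, HuberWustholz2022
[crux] The rational (= Baker) sector of dimension ≤ 1 closes INSIDE dimension ≤ 1: two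
representations of KZ's literal shape of dimensions ≤ 1 with equal values are connected by moves
among representations of dimension ≤ 1. Budgeted refinement of LowDimension's crux
stmt-KontsevichZagierPeriods-0405 (same normal form: cell decomposition of the domain, partial
fractions by integrand additivity, affine/Möbius/power-map changes of variables, Newton–Leibniz 1→0
with rational/algebraic primitives, Baker — PROVED in tree as
Literature.NumberTheory.Transcendental.baker_holds — to reduce ℚ̄-relations among 1, log α_j, arg
w_k to multiplicative ℤ-relations, realised by domain additivity + x ↦ αx, x ↦ x^N, Möbius
doubling); the new content is that no step leaves dimension ≤ 1 (no product representation, no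
Fubini). [difficulty: L] -/
@[route_item "route-KontsevichZagierPeriods-DimensionBudget"]
def BakerSectorDimOne : Prop :=
  ∀ ⦃n m : ℕ⦄, n ≤ 1 → m ≤ 1 → ∀ (r : Literature.NumberTheory.Transcendental.KZ.IntegralRep n) (r' : Literature.NumberTheory.Transcendental.KZ.IntegralRep m), r.IsRational → r'.IsRational → r.value = r'.value → Literature.NumberTheory.Transcendental.KZ.of r - Literature.NumberTheory.Transcendental.KZ.of r' ∈ AddSubgroup.closure ((Literature.NumberTheory.Transcendental.KZ.domainAddRel ∪ Literature.NumberTheory.Transcendental.KZ.integrandAddRel ∪ Literature.NumberTheory.Transcendental.KZ.changeOfVariablesRel ∪ Literature.NumberTheory.Transcendental.KZ.newtonLeibnizRel) ∩ (AddSubgroup.closure {x : Literature.NumberTheory.Transcendental.KZ.FormalRep | ∃ (k : ℕ) (s : Literature.NumberTheory.Transcendental.KZ.IntegralRep k), k ≤ 1 ∧ x = Literature.NumberTheory.Transcendental.KZ.of s} : Set Literature.NumberTheory.Transcendental.KZ.FormalRep))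

/-- item stmt-KontsevichZagierPeriods-3751 · crux · rank 4 · open · by planner
why it might fail: Needs Huber–Wüstholz Thm 13.3 (not in tree) to turn equal values into generators; functoriality through NON-real paths may need homotopies whose Stokes realisation nests (d = 3), and every intermediate curve-type period must be the real part of an absolutely convergent rep.
sources: HuberWustholz2022, HuberMullerStachPeriods2017, KontsevichZagier2001, Ayoub2015
[crux] One extra dimension suffices in dimension 1 (the corrected d(1)-conjecture, d(1) = 2):
whenever two representations of dimensions ≤ 1 (semialgebraic integrands: all 1-periods of curve
type, real parts) are KZ-equivalent, they are connected by moves among representations of dimension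
≤ 2. Expected proof: soundness (relations_le_ker_eval_holds) gives equal values; HuberWustholz2022
Thm 13.3(2) (all ℚ̄-linear relations among curve-type periods come from bilinearity and
functoriality of pairs (C,D) of smooth affine curves, plus boundary maps) supplies generators;
realisation: (A) = integrand/domain additivity (dim 1), (B) = chain rule along semialgebraic paths
(dim 1, literally EqOn of integrands), homology/boundary relations (C) = Green on semialgebraic
2-chains in C(ℂ) ⊂ ℝ⁴ pulled back to parameter squares (dim 2). [difficulty: XL] -/
@[route_item "route-KontsevichZagierPeriods-DimensionBudget"]
def DimOneWithinTwo : Prop :=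
  ∀ ⦃n m : ℕ⦄, n ≤ 1 → m ≤ 1 → ∀ (r : Literature.NumberTheory.Transcendental.KZ.IntegralRep n) (r' : Literature.NumberTheory.Transcendental.KZ.IntegralRep m), Literature.NumberTheory.Transcendental.KZ.Equivalent r r' → Literature.NumberTheory.Transcendental.KZ.of r - Literature.NumberTheory.Transcendental.KZ.of r' ∈ AddSubgroup.closure ((Literature.NumberTheory.Transcendental.KZ.domainAddRel ∪ Literature.NumberTheory.Transcendental.KZ.integrandAddRel ∪ Literature.NumberTheory.Transcendental.KZ.changeOfVariablesRel ∪ Literature.NumberTheory.Transcendental.KZ.newtonLeibnizRel) ∩ (AddSubgroup.closure {x : Literature.NumberTheory.Transcendental.KZ.FormalRep | ∃ (k : ℕ) (s : Literature.NumberTheory.Transcendental.KZ.IntegralRep k), k ≤ 2 ∧ x = Literature.NumberTheory.Transcendental.KZ.of s} : Set Literature.NumberTheory.Transcendental.KZ.FormalRep))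

/-- item stmt-KontsevichZagierPeriods-18187 · crux · rank 5 · open · by planner
why it might fail: The budget: Ayoub2015 Rem 1.2 expects n-variable cube identities to need MORE than n+1 variables; false iff a vanishing ℤ-combination of tame cubes of dim ≤ K (weight-K MZV, genus-2/Legendre relation) has no chain inside K+1, via a truncated invariant of K_≤(K+1). Unbudgeted shadow follows from S.
sources: Ayoub2015, Ayoub2014, KontsevichZagier2001, HuberMullerStach2017, Fresan2024, Wan2011
[crux, piece 2 of the split of BudgetThesis; NEW — the route's budget thesis on the cubical sector]
the tame cubical kernel closes inside ONE extra dimension: for every K, every ℤ-combination x of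
tame cube representations (domain [0,1]^j literally {z | ∀ i, 0 ≤ z i ∧ z i ≤ 1}, integrand
real-analytic near the closed cube — `KZ.IntegralRep.IsTameCube` unfolded; Ayoub's generators
∫_{[0,1]^j} f) of dimensions j ≤ K with KZ.eval x = 0 lies in KZ.relationsLE (K+1), i.e. is a chain
of moves among representations of dimension ≤ K+1. = Conjecture 1 on Ayoub's cubical presentation
(Ayoub2014 §2.2) + the route's answer '+1' to Ayoub2015 Rem 1.2/1.5 ('how many variables does a
rules-proof need'; in KZ's calculus substitution is rule (2) and costs nothing — the bet). NOT
summit-strength: it decides only cube combinations (compilation = piece 1 is open), and its budget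
is not implied by the summit. Foreseen line: AyoubKernelWithin (x ∈ the span of the four cubical
move families `KZ.cubicalLinGens ∪ cubicalStokesGens ∪ cubicalCovGens ∪ cubicalSubdivGens` supported
in dim ≤ K+1 — Kontsevich's period conjecture in Ayoub's presentation, budgeted) + AyoubSpanWithin
(that span ≤ relationsLE (K+1); -/
@[route_item "route-KontsevichZagierPeriods-DimensionBudget"]
def CubicalKernelWithinOne : Prop :=
  ∀ (K : ℕ) (x : Literature.NumberTheory.Transcendental.KZ.FormalRep), x ∈ AddSubgroup.closure {y : Literature.NumberTheory.Transcendental.KZ.FormalRep | ∃ (j : ℕ) (t : Literature.NumberTheory.Transcendental.KZ.IntegralRep j), j ≤ K ∧ (t.domain = {z : Fin j → ℝ | ∀ i, 0 ≤ z i ∧ z i ≤ 1} ∧ AnalyticOnNhd ℝ t.integrand {z : Fin j → ℝ | ∀ i, 0 ≤ z i ∧ z i ≤ 1}) ∧ y = Literature.NumberTheory.Transcendental.KZ.of t} → Literature.NumberTheory.Transcendental.KZ.eval x = 0 → x ∈ Literature.NumberTheory.Transcendental.KZ.relationsLE (K + 1)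

/-- item stmt-KontsevichZagierPeriods-3574 · crux · rank 6 · closed · proved by Summit.KontsevichZagierPeriods.SymplecticScissors.CubeNashNormalForm.cubeNashNormalForm_symplecticScissors_proof @ d70c8da77019 (prover) · by planner
why it might fail: General case = embedded resolution over ℝ realised by moves (Hironaka1964, BierstoneMilman1988 rectilinearisation), absent from tree+Mathlib; a needed chart with Jacobian not Nash up to the CLOSED cube, or a non-injective blow-down piece, breaks the transcription (prover verdict 08-16: open, XL).
sources: KontsevichZagier2001, HuberMullerStach2017, BochnakCosteRoy1998, Hironaka1964, BierstoneMilman1988, Ayoub2014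
[support] (card PencilNormalForm) every difference of KZ-rational representations is KZ-equivalent
to a ℤ-combination of cube representations ∫_{[0,1]^{n_i}} g_i with g_i ℚ-semialgebraic and
real-analytic on a neighbourhood of the closed cube (semialgebraic triangulation + resolution +
ramified substitutions u = w^N, all realised by additivity and change-of-variables moves; null faces
are relations by domain additivity). [difficulty: L] -/
@[route_item "route-KontsevichZagierPeriods-DimensionBudget"]
def CubeNashNormalForm : Prop :=
  ∀ (k k' : ℕ) (r : Literature.NumberTheory.Transcendental.KZ.IntegralRep k) (r' : Literature.NumberTheory.Transcendental.KZ.IntegralRep k'), r.IsRational → r'.IsRational → ∃ (S : ℕ) (n : Fin S → ℕ) (g : (i : Fin S) → (Fin (n i) → ℝ) → ℝ) (U : (i : Fin S) → Set (Fin (n i) → ℝ)) (ε : Fin S → ℤ) (s : (i : Fin S) → Literature.NumberTheory.Transcendental.KZ.IntegralRep (n i)), (∀ i, IsOpen (U i) ∧ Set.pi Set.univ (fun _ : Fin (n i) => Set.Icc (0:ℝ) 1) ⊆ (U i) ∧ Literature.NumberTheory.Transcendental.IsSemialgebraicFunOn ℚ (U i) (g i) ∧ AnalyticOnNhd ℝ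 (g i) (U i)) ∧ (∀ i, (s i).domain = Set.pi Set.univ (fun _ : Fin (n i) => Set.Icc (0:ℝ) 1) ∧ ∀ z ∈ Set.pi Set.univ (fun _ : Fin (n i) => Set.Icc (0:ℝ) 1), (s i).integrand z = g i z) ∧ Literature.NumberTheory.Transcendental.KZ.of r - Literature.NumberTheory.Transcendental.KZ.of r' - ∑ i, ε i • Literature.NumberTheory.Transcendental.KZ.of (s i) ∈ Literature.NumberTheory.Transcendental.KZ.relations

/-- item stmt-KontsevichZagierPeriods-3754 · crux (kind.auto-crux: conjecture-grade) · rank 9 · open · by planner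
why it might fail: auto-crux — conjecture-grade statement (docstring avows it ('conjecturally')); it is open, so it may simply be false
sources: KontsevichZagier2001, Baker1975
[support] Effective KZ in the logarithmic sector is TWO moves: if ∫_a^b c dx/x = ∫_a'^b' c' dx/x
(rational data, c ≠ 0) then with α = b/a, β = b'/a', α^P = β^Q (P, Q ≥ 1 from c/c' = P/Q) and δ =
α^(1/Q) = β^(1/P) (real algebraic), the power maps y ↦ a·y^Q and y ↦ a'·y^P send the single rep
∫_1^δ (cQ) dy/y (cQ = c'P) onto r and r' — two change-of-variables instances, both supported in
dimension 1, independent of all heights. Shows that proof LENGTH in the Baker sector is governed by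
power maps (the card's (E) is O_δ(1) in the pure-log sector; conjecturally O_δ(log log H) in general
because e-fold angle multiplication needs Möbius doubling). [difficulty: M] -/
@[route_item "route-KontsevichZagierPeriods-DimensionBudget"]
def LogSectorTwoMoves : Prop :=
  ∀ (a b c a' b' c' : ℚ), 0 < a → a < b → 0 < a' → a' < b' → c ≠ 0 → ∀ (r r' : Literature.NumberTheory.Transcendental.KZ.IntegralRep 1), r.domain = {x | (a : ℝ) < x 0 ∧ x 0 < (b : ℝ)} → Set.EqOn r.integrand (fun x => (c : ℝ) / x 0) r.domain → r'.domain = {x | (a' : ℝ) < x 0 ∧ x 0 < (b' : ℝ)} → Set.EqOn r'.integrand (fun x => (c' : ℝ) / x 0) r'.domain → r.value = r'.value → ∃ l : List Literature.NumberTheory.Transcendental.KZ.FormalRep, l.length ≤ 2 ∧ (∀ e ∈ l, e ∈ ((Literature.NumberTheory.Transcendental.KZ.domainAddRel ∪ Literature.NumberTheory.Transcendental.KZ.integrandAddRel ∪ Literature.NumberTheory.Transcendental.KZ.changeOfVariablesRel ∪ Literature.NumberTheory.Transcendental.KZ.newtonLeibnizRel) ∩ (AddSubgroup.closure {x : Literature.NumberTheory.Transcendental.KZ.FormalRep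 | ∃ (k : ℕ) (s : Literature.NumberTheory.Transcendental.KZ.IntegralRep k), k ≤ 1 ∧ x = Literature.NumberTheory.Transcendental.KZ.of s} : Set Literature.NumberTheory.Transcendental.KZ.FormalRep)) ∨ -e ∈ ((Literature.NumberTheory.Transcendental.KZ.domainAddRel ∪ Literature.NumberTheory.Transcendental.KZ.integrandAddRel ∪ Literature.NumberTheory.Transcendental.KZ.changeOfVariablesRel ∪ Literature.NumberTheory.Transcendental.KZ.newtonLeibnizRel) ∩ (AddSubgroup.closure {x : Literature.NumberTheory.Transcendental.KZ.FormalRep | ∃ (k : ℕ) (s : Literature.NumberTheory.Transcendental.KZ.IntegralRep k), k ≤ 1 ∧ x = Literature.NumberTheory.Transcendental.KZ.of s} : Set Literature.NumberTheory.Transcendental.KZ.FormalRep))) ∧ l.sum = Literature.NumberTheory.Transcendental.KZ.of r - Literature.NumberTheory.Transcendental.KZ.of r'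

/-- item stmt-KontsevichZagierPeriods-14384 · support · rank 9 · open · by planner
why it might fail: At least summit strength, and sharper: false as soon as one identity of n-dimensional periods is forced only through dimension ≥ n+2 (nested boundary maps, regularised double shuffle, cycles on higher products) — Ayoub2015 Rem 1.2 expects 'plus de n+1 variables'.
sources: KontsevichZagier2001, Ayoub2015, Fresan2024, HuberMullerStachPeriods2017, Wan2011
[support] OPEN CORE of the frame, layers of dimension ≥ 2 (at least summit strength — filed
2026-08-16 on the operator's route-choice hold 'target-unreachable' to make the target's dependency
explicit and to give the budget FUNCTION D(N) a refutable form; NOT for staffing): for two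
representations of KZ's literal shape with max n m ≥ 2 and equal values, [r] − [r'] ∈ KZ.relationsLE
(max n m + 1) — one passes from r to r' by moves among representations of dimension ≤ max n m + 1
('Stokes costs exactly one dimension', the route's slogan, made global: D(N) ≤ N + 1 for N ≥ 2;
layer 1 is cruxes 2–4: D(1) = 2, and = 1 on the Baker sector, crux 3). By padding (r ↦ r × (0,1) is
one Newton–Leibniz move with the semialgebraic primitive t·f(x)) it implies Conjecture 1 outright,
with d ≤ 3 on layer ≤ 1, so it inherits the summit's strength barriers (kzConjecture_implies_*); it
is SHARPER than the summit and separately refutable: an identity between n-dimensional rational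
representations that provably needs a representation of dimension n + 2 kills it without touching
the summit (pivot: restate with the witnessed budget; the budget function becomes the object).
Calibrations in the tree, all cons -/
@[route_item "route-KontsevichZagierPeriods-DimensionBudget"]
def OneExtraDimension : Prop :=
  ∀ ⦃n m : ℕ⦄, 2 ≤ max n m → ∀ (r : Literature.NumberTheory.Transcendental.KZ.IntegralRep n) (r' : Literature.NumberTheory.Transcendental.KZ.IntegralRep m), r.IsRational → r'.IsRational → r.value = r'.value → Literature.NumberTheory.Transcendental.KZ.EquivalentLE (max n m + 1) r r'

/-- item stmt-KontsevichZagierPeriods-14385 · support · rank 9 · closed · proved by Summit.KontsevichZagierPeriods.DimensionBudget.budgetGlue_proof @ d00912bc290a (prover) · by planner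
sources: KontsevichZagier2001
[glue] provable now (planner's Sketch.lean `budgetGlue_holds`, lean check rc 0, attached as
evidence): BakerSectorDimOne → OneExtraDimension → BudgetThesis by a case split on max n m — if max
n m ≤ 1 take d := 1 (BakerSectorDimOne with n ≤ 1, m ≤ 1), else d := max n m + 1 (OneExtraDimension;
KZ.EquivalentLE / KZ.relationsLE unfold to the inlined truncation by rfl). Makes the target
BudgetThesis the conclusion of the route's two layers (dimension ≤ 1: the Baker sector with its
sharp budget 1; dimension ≥ 2: the open core). Cruxes DimOneNotConservative and DimOneWithinTwo
measure the budget function at layer 1 (D(1) = 2 exactly) and stay outside the glue by design.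
[difficulty: provable-now] -/
@[route_item "route-KontsevichZagierPeriods-DimensionBudget"]
def BudgetGlue : Prop :=
  BakerSectorDimOne → OneExtraDimension → BudgetThesis

/-- item stmt-KontsevichZagierPeriods-18188 · support · rank 9 · closed · proved by Summit.KontsevichZagierPeriods.DimensionBudget.budgetThesisOfSubs_proof @ 126a5d1421a4 (prover) · by planner
sources: KontsevichZagier2001, Ayoub2015
[glue] SPLIT GLUE of the deciding crux BudgetThesis (crux-strategist BC2 redirect, RESTATED re-audit
r1, 2026-08-17; the formal parent→children edge `route edit --split BudgetThesis --into
CubeNashNormalForm CubicalKernelWithinOne` is reserved by the gate to a seat's final cycle — the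
tenure planner files it with --glue-by once this lands): CubeNashNormalForm → CubicalKernelWithinOne
→ BudgetThesis. PROVABLE NOW and PROVED against the tree (strategist's
DimensionBudgetBudgetThesisSplit.lean, theorem budgetThesis_of_subs, attached as evidence on
stmt-KontsevichZagierPeriods-3748: lean check rc 0, sorries 0, axioms
propext/Classical.choice/Quot.sound; a prover pastes it). Proof (≈ 85 lines, NOT a one-liner seam):
given KZ-rational r, r' with equal values, compile [r] − [r'] to a ℤ-combination x of cube–Nash
representations (CubeNashNormalForm); replace each cube–Nash rep s by the tame rep t of its Nash
extension INSIDE ITS OWN DIMENSION by two integrand-additivity instances ([s] − [t] − [z], z =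
(cube, 0); minus [z] − [z] − [z]) — lemma exists_isTameCube_sub_mem_relationsLE — getting y in the
tame cubical span of dimension ≤ K := max cube dimension with x − y ∈ KZ.relationsLE K; soun -/
@[route_item "route-KontsevichZagierPeriods-DimensionBudget"]
def BudgetThesisOfSubs : Prop :=
  CubeNashNormalForm → CubicalKernelWithinOne → BudgetThesis

/-- item stmt-KontsevichZagierPeriods-3752 · support · rank 9 · closed · proved by Summit.KontsevichZagierPeriods.DimensionBudget.exhaustion_proof @ ab8a8d9d2cbf (prover) · by planner
sources: KontsevichZagier2001
[support] The dimension filtration exhausts the relations: relations = ⨆_d relations_≤d (every move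
instance is supported in the dimension of its representations; conversely relations_≤d ≤ relations
by closure_mono). With BudgetThesis this shows the target is an honest reformulation of the summit.
Provable now (AddSubgroup.closure_le / mem_iSup_of_directed). [difficulty: provable-now] -/
@[route_item "route-KontsevichZagierPeriods-DimensionBudget"]
def Exhaustion : Prop :=
  Literature.NumberTheory.Transcendental.KZ.relations = ⨆ d : ℕ, AddSubgroup.closure ((Literature.NumberTheory.Transcendental.KZ.domainAddRel ∪ Literature.NumberTheory.Transcendental.KZ.integrandAddRel ∪ Literature.NumberTheory.Transcendental.KZ.changeOfVariablesRel ∪ Literature.NumberTheory.Transcendental.KZ.newtonLeibnizRel) ∩ (AddSubgroup.closure {x : Literature.NumberTheory.Transcendental.KZ.FormalRep | ∃ (k : ℕ) (s : Literature.NumberTheory.Transcendental.KZ.IntegralRep k), k ≤ d ∧ x = Literature.NumberTheory.Transcendental.KZ.of s} : Set Literature.NumberTheory.Transcendental.KZ.FormalRep))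

/-- item stmt-KontsevichZagierPeriods-3753 · support · rank 9 · open · by planner
sources: BeukersCalabiKolk1993, KontsevichZagier2001
[support] Calibration of the budget at d = 2: Euler's ζ(2) = π²/6, as the pair (∫∫_(0,1)²
dxdy/(1−xy), ∫∫_(0,1)² (8/3)dxdy/((1+x²)(1+y²))), closes INSIDE dimension 2 in about ten moves:
integrand additivity 1/(1−xy) = 1/(1−x²y²) + xy/(1−x²y²); change of variables (x²,y²) turns the odd
part into a quarter of the whole; the scaling endomorphism of FormalRep (integrands × λ, λ real
algebraic) preserves relations_≤d, giving ζ-rep ≡ (4/3)·S; the ALGEBRAIC Calabi map Φ(s,t) =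
(s/√(1−t²), t/√(1−s²)) from the quarter disc onto (0,1)² (Beukers–Calabi–Kolk) pulls dxdy/(1−x²y²)
back to ds dt/(√(1−s²)√(1−t²)); the involution (s,t) ↦ (√(1−s²),√(1−t²)) swaps quarter disc and its
complement in the square preserving that integrand, so quarter disc = half the square (domain
additivity); finally the product change of variables (s,t) = (2x/(1+x²), 2y/(1+y²)) maps (2/3)ds
dt/(√(1−s²)√(1−t²)) on (0,1)² to (8/3)dxdy/((1+x²)(1+y²)). No third variable: evidence that
Fubini-type product identities do not force d = 3. [difficulty: L] -/
@[route_item "route-KontsevichZagierPeriods-DimensionBudget"]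
def BaselWithinTwo : Prop :=
  ∀ (r r' : Literature.NumberTheory.Transcendental.KZ.IntegralRep 2), r.domain = {x | ∀ i, x i ∈ Set.Ioo (0:ℝ) 1} → Set.EqOn r.integrand (fun x => 1 / (1 - x 0 * x 1)) r.domain → r'.domain = {x | ∀ i, x i ∈ Set.Ioo (0:ℝ) 1} → Set.EqOn r'.integrand (fun x => 8 / (3 * ((1 + x 0 ^ 2) * (1 + x 1 ^ 2)))) r'.domain → Literature.NumberTheory.Transcendental.KZ.of r - Literature.NumberTheory.Transcendental.KZ.of r' ∈ AddSubgroup.closure ((Literature.NumberTheory.Transcendental.KZ.domainAddRel ∪ Literature.NumberTheory.Transcendental.KZ.integrandAddRel ∪ Literature.NumberTheory.Transcendental.KZ.changeOfVariablesRel ∪ Literature.NumberTheory.Transcendental.KZ.newtonLeibnizRel) ∩ (AddSubgroup.closure {x : Literature.NumberTheory.Transcendental.KZ.FormalRep | ∃ (k : ℕ) (s : Literature.NumberTheory.Transcendental.KZ.IntegralRep k), k ≤ 2 ∧ x = Literature.NumberTheory.Transcendental.KZ.of s} : Set Literature.NumberTheory.Transcendental.KZ.FormalRep))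

/-- item stmt-KontsevichZagierPeriods-3755 · assembly · rank 1 · closed · proved by Summit.KontsevichZagierPeriods.DimensionBudget.assembly_proof @ 71d4d39983ab (prover) · by planner
sources: KontsevichZagier2001
[assembly] BudgetThesis → KontsevichZagierPeriods (specialise, then relations_≤d ≤ relations). -/
@[route_item "route-KontsevichZagierPeriods-DimensionBudget"]
def Assembly : Prop :=
  BudgetThesis → KontsevichZagierPeriods

/-! D-0027 §2.1 — DECIDING THEOREM (planner-authored via `route open/edit --closes-file`; by planner-rbadge-KontsevichZagierPeriods-Dimensi-4e150075-g2-0 2026-08-15T16:11:44Z):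
its hypotheses are this route's items and its conclusion the sub-problem Statement (glue_lint), and it elaborates with this file. -/

@[closes "route-KontsevichZagierPeriods-DimensionBudget"] theorem closes (h : BudgetThesis) : KontsevichZagierPeriods := by
  intro n m r r' hr hr' hv
  obtain ⟨d, hd⟩ := h r r' hr hr' hv
  show Literature.NumberTheory.Transcendental.KZ.of r - Literature.NumberTheory.Transcendental.KZ.of r' ∈
    Literature.NumberTheory.Transcendental.KZ.relations
  exact AddSubgroup.closure_mono Set.inter_subset_left hd

end Summit.KontsevichZagierPeriods.KontsevichZagierPeriods.Theses.DimensionBudget
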